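import Summits.QuantumFields.YangMills.Theorems.BalabanUVNodesPortU8LocUnivDecayClause1
import Literature.MathematicalPhysics.QuantumFieldTheory.Balaban1983to89.B5Hk163TorusHolderDecay

/-!
# PORT PT-B (U8), g4 file 9 — NODE v8 LEAF (D1): THE FIRST-DIFFERENCE CLAUSE OF (‴-LocUniv), PROVED —
# ★★★ `norm_recordHrLocξ_univ_shift_sub_le`: `‖HrLocξ_univ(b + e_ν) − HrLocξ_univ(b)‖ ≤ C₂(a)·η²·e^{−δ₁·tdist(coarsenTo (k+1) b₋, y)}`, `C₂(a) = MD163(4)·periodConst(κ₁₆₃(4),3)·‖ρ₈(bV a)‖`,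
# `δ₁ = κ₁₆₃(4)∕4∕4`, from b05's FIRST-DIFFERENCE kernel decay ✓`B5Hk163TorusHolderDecay.norm_dker_bpt_le` of [B5] (1.63) along the (D1) identification of g4 file 7

Cell `ym-nodeO-ideate` ∕ `ym-balaban-port`, porter `ymgap-nodeO-port-PTB-1` (gen 4).  JOIN-side helper for **stmt-QuantumFields-27238** (K0ᴬ), `--supports … --as helper`.
Clause 2 (of four) of the displayed hypothesis (‴-LocUniv) of ✓`response9D_LocUniv_of_tokens` ∕ ✓`portPieceLocalityU8_LocUniv` becomes a THEOREM (clause 1: ✓ g4 file 8).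
[B5] = [Balaban1984PropagatorsI], [B6] = [Balaban1984PropagatorsII], [15] = [Balaban1985Variational], [I] = [Balaban1987RG1].

WHAT IS PROVED (kernel, sorry-free).
§1 `windowResp_univ_shift_sub_eq` — `windowResp univ l ⟨b₋ + e_ν, μ_b⟩ − windowResp univ l b = Re (n⁻¹ · dker n Mk μ_b l₁ ν (EK b₋) l₂)` (`n = L^{k+1}`; ✓`EK_shift`, the `dker` of
   ✓`B5Hk163TorusHolder`), `abs_windowResp_univ_shift_sub_le` (its decay, ✓`norm_dker_bpt_le`).
§2 `recordHrLocξ_sub_eq_smul` ∕ `norm_recordHrLocξ_sub_eq` (colour wrapper for differences), ★★★ `norm_recordHrLocξ_univ_shift_sub_le` (the clause, explicit constants; off the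
   standing range both sides vanish).

HONEST FRAMING.  Two of the four (190)-type clauses of ONE displayed token are now theorems (from [B5] (1.63)'s proved kernel and first-difference decay); clauses 3–4 (second
differences, η³) and Tok-cmpU-cap stay displayed; nothing of [15] Prop. 9 ∕ [I] Thm 1 at the record claimed beyond that; K0ᴬ 27238 OPEN; NODE O 0∕1; COUNT 8∕28 · K 1∕4
UNMOVED; finite `𝕋⁴_{L^K}` at fixed ε — NOT continuum ∕ OS ∕ Clay; **the Yang–Mills mass gap (Clay) is NOT proved by any of this.**
-/

noncomputable section

open scoped BigOperators

namespace Summit.QuantumFields.YangMills.Theorems.PortU8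

open Literature.MathematicalPhysics.QuantumFieldTheory.Balaban1983to89
open Literature.MathematicalPhysics.QuantumFieldTheory.Balaban1983to89.T4Continuum (T4Family)
open Literature.MathematicalPhysics.QuantumFieldTheory.Balaban1983to89.B5Eq117TorusCarriers (Mk EK)
open Literature.MathematicalPhysics.QuantumFieldTheory.Balaban1983to89.B5Eq118OneStroke (iterBlockOf)
open Literature.MathematicalPhysics.QuantumFieldTheory.Balaban1983to89.B4TorusKernel (periodConst)
open Literature.MathematicalPhysics.QuantumFieldTheory.Balaban1983to89.B4TorusKernel.MultiPeriod (torusSupNorm)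
open Literature.MathematicalPhysics.QuantumFieldTheory.Balaban1983to89.B6LowerBound2153Torus (rep toT toT_rep)
open Literature.MathematicalPhysics.QuantumFieldTheory.Balaban1983to89.B5Hk163Strip (kappa163 kappa163_pos)
open Literature.MathematicalPhysics.QuantumFieldTheory.Balaban1983to89.B5Hk163Torus (HkOp hker)
open Literature.MathematicalPhysics.QuantumFieldTheory.Balaban1983to89.B5Hk163TorusHolder (dker)
open Literature.MathematicalPhysics.QuantumFieldTheory.Balaban1983to89.B5Hk163TorusHolderDecay (MD163 norm_dker_bpt_le)
open Literature.MathematicalPhysics.QuantumFieldTheory.Balaban1983to89.B5Prop11Plancherel (Tor fine unitVec)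
open Summit.QuantumFields.YangMills.Theorems.K0RecordFormatNames

variable (F : T4Family) {k K : ℕ}

/-! ## §1  The first difference of the whole-torus window response is `n⁻¹ · dker`, and it decays -/

/-- **FIRST DIFFERENCE = `n⁻¹·dker`**: `windowResp univ l ⟨b₋ + e_ν, μ_b⟩ − windowResp univ l b = Re ((L^{k+1})⁻¹ · dker (L^{k+1}) Mk μ_b l₁ ν (EK b₋) l₂)`.
[cite: Balaban1984PropagatorsI, (1.63) p.28, p.29 «∂_ν(H_kB)»; Balaban1984PropagatorsII, (2.35) p.228] -/
theorem windowResp_univ_shift_sub_eq (hk : k + 1 ≤ (F.P K).m + (F.P K).K) (l : RespLabel F k K) (b : PBond (F.P K) 0) (ν : Fin (F.P K).d) :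
    windowResp F k K Finset.univ l ⟨b.src.shift ν, b.dir⟩ - windowResp F k K Finset.univ l b =
      ((((F.P K).L ^ (k + 1) : ℕ) : ℂ)⁻¹ * dker ((F.P K).L ^ (k + 1)) (Mk (F.P K) (k + 1)) b.dir l.1 ν (EK hk b.src) l.2).re := by
  haveI : NeZero (F.P K).L := ⟨(F.P K).L_pos.ne'⟩
  have hn : ((((F.P K).L ^ (k + 1) : ℕ)) : ℂ) ≠ 0 := by exact_mod_cast (pow_pos (F.P K).L_pos (k + 1)).ne'
  rw [windowResp_univ_eq_re_HkOp F hk l ⟨b.src.shift ν, b.dir⟩, windowResp_univ_eq_re_HkOp F hk l b, ← Complex.sub_re]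
  congr 1
  show hker ((F.P K).L ^ (k + 1)) (Mk (F.P K) (k + 1)) b.dir l.1 (EK hk (b.src.shift ν)) l.2 -
      hker ((F.P K).L ^ (k + 1)) (Mk (F.P K) (k + 1)) b.dir l.1 (EK hk b.src) l.2 = _
  rw [B6HprimeOpNormV1.EK_shift hk b.src ν, dker, ← mul_assoc, inv_mul_cancel₀ hn, one_mul]

/-- **ITS DECAY**: `|windowResp univ l ⟨b₋ + e_ν, μ_b⟩ − windowResp univ l b| ≤ (L^{k+1})⁻¹ · MD163(d)·periodConst(κ₁₆₃(d), d−1) · e^{−(κ₁₆₃(d)∕d)·|y(b₋) − l₂|_{T,∞}}`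
(✓`norm_dker_bpt_le`; `d = (F.P K).d = 4`, the rate's denominator printed `((d−1 : ℕ) : ℝ) + 1`). [cite: Balaban1984PropagatorsI, (1.63) p.28, (1.65)–(1.67) p.29] -/
theorem abs_windowResp_univ_shift_sub_le (hk : k + 1 ≤ (F.P K).m + (F.P K).K) (l : RespLabel F k K) (b : PBond (F.P K) 0) (ν : Fin (F.P K).d) :
    |windowResp F k K Finset.univ l ⟨b.src.shift ν, b.dir⟩ - windowResp F k K Finset.univ l b| ≤
      ((((F.P K).L : ℝ) ^ (k + 1))⁻¹) * (MD163 (F.P K).d * periodConst (kappa163 (F.P K).d) ((F.P K).d - 1) *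
        Real.exp (-(kappa163 (F.P K).d / ((((F.P K).d - 1 : ℕ) : ℝ) + 1) *
          torusSupNorm (Mk (F.P K) (k + 1)) (rep (Mk (F.P K) (k + 1)) (iterBlockOf (k + 1) b.src) - rep (Mk (F.P K) (k + 1)) l.2)))) := by
  classical
  haveI : NeZero (F.P K).L := ⟨(F.P K).L_pos.ne'⟩
  rw [windowResp_univ_shift_sub_eq F hk l b ν]
  refine (Complex.abs_re_le_norm _).trans ?_
  rw [norm_mul, norm_inv, Complex.norm_natCast, Nat.cast_pow]
  refine mul_le_mul_of_nonneg_left ?_ (by positivity)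
  obtain ⟨y', r, hb⟩ := B5G183Kernel.exists_eq_bpt ((F.P K).L ^ (k + 1)) (Mk (F.P K) (k + 1)) (EK hk b.src)
  have hy' : iterBlockOf (k + 1) b.src = y' := by
    rw [← B6BlockDecayHjCovV1.blockOf_EK_eq_iterBlockOf hk, hb, B5Blocks16.blockOf_bpt]
  rw [hy', hb]
  have h := norm_dker_bpt_le ((F.P K).L ^ (k + 1)) (Mk (F.P K) (k + 1)) b.dir l.1 ν r (rep (Mk (F.P K) (k + 1)) y') (rep (Mk (F.P K) (k + 1)) l.2)
  rw [toT_rep, toT_rep] at h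
  exact h

/-! ## §2  ★★★ The first-difference clause of (‴-LocUniv), with explicit volume-uniform constants -/

/-- The colour wrapper commutes with differences: `HrLocξ W a l b′ − HrLocξ W a l b = (ξ·(windowResp b′ − windowResp b)) • ρ₈(bV a)`.
[cite: Balaban1987RG1, (3.37) p.277 (bookkeeping)] -/
theorem norm_recordHrLocξ_sub_eq (a₀ ε₂₉ : ℝ) (k K : ℕ) (W : Finset (Site (F.P K) (k + 1))) (a : (thetaFill F a₀ ε₂₉).ιβ) (l : RespLabel F k K)
    (b b' : PBond (F.P K) 0) :
    letI θ := thetaFill F a₀ ε₂₉; letI := θ.instVβ₁; letI := θ.instVβ₂; letI := θ.instιβ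
    ‖recordHrLocξ F θ k K W a l b' - recordHrLocξ F θ k K W a l b‖ =
      (F.P K).eta (k + 1) * |windowResp F k K W l b' - windowResp F k K W l b| * ‖fun i i' : Fin 2 => θ.ρ8 (θ.bV a) i i'‖ := by
  letI θ := thetaFill F a₀ ε₂₉; letI := θ.instVβ₁; letI := θ.instVβ₂; letI := θ.instιβ
  have hη0 : 0 ≤ (F.P K).eta (k + 1) := by unfold Params.eta; exact (pow_pos (inv_pos.2 (F.P K).cast_L_pos) _).le
  have h : recordHrLocξ F θ k K W a l b' - recordHrLocξ F θ k K W a l b =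
      (((F.P K).eta (k + 1) * (windowResp F k K W l b' - windowResp F k K W l b) : ℝ) : ℂ) • (fun i i' : Fin 2 => θ.ρ8 (θ.bV a) i i') := by
    funext i i'
    simp only [recordHrLocξ, windowRespξ, Pi.sub_apply, Pi.smul_apply, smul_eq_mul]
    push_cast
    ring
  rw [h, norm_smul, Complex.norm_real, Real.norm_eq_abs, abs_mul, abs_of_nonneg hη0]

/-- ★★★ **THE FIRST-DIFFERENCE CLAUSE OF (‴-LocUniv), PROVED**: for every `K`, `k`, colour `a`, label `(μ, y)`, fine bond `b` and direction `ν`,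
`‖recordHrLocξ F θ k K univ a (μ,y) ⟨b₋ + e_ν, μ_b⟩ − recordHrLocξ F θ k K univ a (μ,y) b‖ ≤ C₂(a)·η²·e^{−δ₁·tdist(coarsenTo (k+1) b₋, y)}`, `η = eta (k+1)`,
`C₂(a) = MD163(d)·periodConst(κ₁₆₃(d), d−1)·‖ρ₈(bV a)‖`, `δ₁ = (κ₁₆₃(d)∕d)∕4` (`d = 4`).  From ✓`norm_dker_bpt_le` ([B5] (1.63)) and ✓`tdist_le_mul_torusSupNorm`.
[cite: Balaban1984PropagatorsI, (1.63) p.28, (1.65)–(1.67) p.29; Balaban1984PropagatorsII, (2.35) p.228, Cor. 2.8 (2.151) p.249; Balaban1985Variational, (190) p.308 (second line); Balaban1987RG1, (4.35) p.290] -/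
theorem norm_recordHrLocξ_univ_shift_sub_le (a₀ ε₂₉ : ℝ) (k K : ℕ) (a : (thetaFill F a₀ ε₂₉).ιβ) (μ : Fin (F.P K).d) (y : Site (F.P K) (k + 1))
    (b : PBond (F.P K) 0) (ν : Fin (F.P K).d) :
    letI θ := thetaFill F a₀ ε₂₉; letI := θ.instVβ₁; letI := θ.instVβ₂; letI := θ.instιβ
    ‖recordHrLocξ F θ k K Finset.univ a (μ, y) ⟨b.src.shift ν, b.dir⟩ - recordHrLocξ F θ k K Finset.univ a (μ, y) b‖ ≤
      (MD163 (F.P K).d * periodConst (kappa163 (F.P K).d) ((F.P K).d - 1) * ‖fun i i' : Fin 2 => θ.ρ8 (θ.bV a) i i'‖) * (F.P K).eta (k + 1) ^ 2 *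
        Real.exp (-((kappa163 (F.P K).d / ((((F.P K).d - 1 : ℕ) : ℝ) + 1) / 4) * (Site.tdist (coarsenTo (k + 1) b.src) y : ℝ))) := by
  letI θ := thetaFill F a₀ ε₂₉; letI := θ.instVβ₁; letI := θ.instVβ₂; letI := θ.instιβ
  set R : ℝ := ‖fun i i' : Fin 2 => θ.ρ8 (θ.bV a) i i'‖ with hR
  set A : ℝ := MD163 (F.P K).d * periodConst (kappa163 (F.P K).d) ((F.P K).d - 1) with hA
  set κ : ℝ := kappa163 (F.P K).d / ((((F.P K).d - 1 : ℕ) : ℝ) + 1) with hκ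
  have hR0 : 0 ≤ R := norm_nonneg _
  have hκ0 : 0 ≤ κ := by rw [hκ]; exact div_nonneg (kappa163_pos _).le (by positivity)
  have hη0 : 0 ≤ (F.P K).eta (k + 1) := by unfold Params.eta; exact (pow_pos (inv_pos.2 (F.P K).cast_L_pos) _).le
  have hηeq : (((F.P K).L : ℝ) ^ (k + 1))⁻¹ = (F.P K).eta (k + 1) := by unfold Params.eta; rw [inv_pow]
  -- sign of the library constant, read off the kernel bound itself at a trivial argument
  have hA0' : 0 ≤ A := by
    have h : ‖dker 1 (Mk (F.P K) (k + 1)) μ μ ν (B5Block118.bpt 1 (Mk (F.P K) (k + 1)) (toT (Mk (F.P K) (k + 1)) 0) fun _ => 0) (toT (Mk (F.P K) (k + 1)) 0)‖ ≤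
        A * Real.exp (-(κ * torusSupNorm (Mk (F.P K) (k + 1)) (0 - 0))) :=
      norm_dker_bpt_le 1 (Mk (F.P K) (k + 1)) μ μ ν (fun _ => 0) 0 0
    have hpos := Real.exp_pos (-(κ * torusSupNorm (Mk (F.P K) (k + 1)) (0 - 0)))
    have h0 := (norm_nonneg _).trans h
    by_contra hneg
    exact absurd h0 (not_le.2 (mul_neg_of_neg_of_pos (lt_of_not_ge hneg) hpos))
  rw [norm_recordHrLocξ_sub_eq]
  by_cases hk : k + 1 ≤ (F.P K).m + (F.P K).K
  · have hw := abs_windowResp_univ_shift_sub_le F hk (μ, y) b ν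
    rw [hηeq] at hw
    have hdist := tdist_le_mul_torusSupNorm F (coarsenTo (k + 1) b.src) y
    have hexp : Real.exp (-(κ * torusSupNorm (Mk (F.P K) (k + 1)) (rep (Mk (F.P K) (k + 1)) (iterBlockOf (k + 1) b.src) - rep (Mk (F.P K) (k + 1)) y))) ≤
        Real.exp (-(κ / 4 * (Site.tdist (coarsenTo (k + 1) b.src) y : ℝ))) := by
      refine Real.exp_le_exp.2 (neg_le_neg ?_)
      rw [← coarsenTo_eq_iterBlockOf]
      have := mul_le_mul_of_nonneg_left hdist hκ0
      linarith
    calc (F.P K).eta (k + 1) * |windowResp F k K Finset.univ (μ, y) ⟨b.src.shift ν, b.dir⟩ - windowResp F k K Finset.univ (μ, y) b| * R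
        ≤ (F.P K).eta (k + 1) * ((F.P K).eta (k + 1) * (A * Real.exp (-(κ / 4 * (Site.tdist (coarsenTo (k + 1) b.src) y : ℝ))))) * R := by
          refine mul_le_mul_of_nonneg_right (mul_le_mul_of_nonneg_left (hw.trans ?_) hη0) hR0
          exact mul_le_mul_of_nonneg_left (mul_le_mul_of_nonneg_left hexp hA0') hη0
      _ = A * R * (F.P K).eta (k + 1) ^ 2 * Real.exp (-(κ / 4 * (Site.tdist (coarsenTo (k + 1) b.src) y : ℝ))) := by ring
  · rw [windowResp_of_not_le F hk, windowResp_of_not_le F hk, sub_zero, abs_zero, mul_zero, zero_mul]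
    positivity

end Summit.QuantumFields.YangMills.Theorems.PortU8

end
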